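import Literature.Analysis.Calculus.NestedFDerivSymmetric   -- ★ p843936: the dictionary nested ↔ `iteratedFDeriv` at orders 3, 4
import HarnessLib

/-!
# Nested Fréchet derivatives of `Θ ∘ A` for a continuous linear map `A`: `Dʲ(Θ∘A)(x)[v₁]…[v_j] = DʲΘ(Ax)[Av₁]…[Av_j]`, `j ≤ 4`
# (Dieudonné, *Foundations of Modern Analysis*, (8.12.10); Hörmander ALPDO I, Thm. 1.1.7)

Topic `Analysis/Calculus`; namespace `Literature.Analysis.Calculus`.  THEOREMS ONLY (no `def`, no instance, no notation, no axiom, no named fact, no `sorry`).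
Generic (real normed spaces).  Written for the TRANSPORT step (blueprint W3) of the (A4-iii) assembly of crux H413 (cell `pub/hodgecm-mathlib`): the jets of
`Θ ∘ Ad κ` (`κ` the frame `[ω⊥ | ω̂ | e₂]`, `Ad κ` a linear map of `M₃(ℂ)`) and of `Θ ∘ (ζ • ·)` at the representative point are the jets of `Θ` at the conjugated∕rescaled
point in the conjugated∕rescaled directions — Mathlib's `ContinuousLinearMap.iteratedFDeriv_comp_right` read through the nested dictionary (★ `NestedFDerivSymmetric`).
* `fderiv_comp_clm_apply` (order 1), `nestedFDeriv_two_comp_clm`, `nestedFDeriv_three_comp_clm`, `nestedFDeriv_four_comp_clm`; and `iteratedFDeriv_comp_clm_vec` (any order, `![…]`-free form).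
HONEST LABEL: calculus plumbing; pays nothing by itself (HC_CM is proved only modulo the printed citations until rung 0 closes).

## References
* [Dieudonne1960] J. Dieudonné, *Foundations of Modern Analysis* (1960), Ch. VIII §12, (8.12.10) (higher derivatives of a composite with a linear map).
* [HormanderALPDO1] L. Hörmander, *The Analysis of Linear Partial Differential Operators I*, 2nd ed. (1990), Thm. 1.1.7.
-/

noncomputable section

open Function

namespace Literature.Analysis.Calculus

variable {E E' F : Type*} [NormedAddCommGroup E] [NormedSpace ℝ E] [NormedAddCommGroup E'] [NormedSpace ℝ E']
  [NormedAddCommGroup F] [NormedSpace ℝ F]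

/-- **Any order, `iteratedFDeriv` form**: `Dʲ(Θ∘A)(x)[m] = DʲΘ(Ax)[A ∘ m]` for a continuous linear `A` and `Θ ∈ Cⁿ`, `j ≤ n`
(Mathlib `ContinuousLinearMap.iteratedFDeriv_comp_right`, applied). [cite: Dieudonne1960, Ch. VIII §12 (8.12.10)] -/
theorem iteratedFDeriv_comp_clm_apply (A : E →L[ℝ] E') {Θ : E' → F} {n : WithTop ℕ∞} (hΘ : ContDiff ℝ n Θ) (x : E) {j : ℕ}
    (hj : (j : WithTop ℕ∞) ≤ n) (m : Fin j → E) :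
    iteratedFDeriv ℝ j (Θ ∘ A) x m = iteratedFDeriv ℝ j Θ (A x) (fun i => A (m i)) := by
  rw [A.iteratedFDeriv_comp_right hΘ x hj, ContinuousMultilinearMap.compContinuousLinearMap_apply]

/-- **Order one**: `D(Θ∘A)(x)[v] = DΘ(Ax)[Av]` for `Θ` differentiable at `Ax`. [cite: Dieudonne1960, Ch. VIII §12 (8.12.10)] -/
theorem fderiv_comp_clm_apply (A : E →L[ℝ] E') {Θ : E' → F} {x : E} (hΘ : DifferentiableAt ℝ Θ (A x)) (v : E) :
    fderiv ℝ (Θ ∘ A) x v = fderiv ℝ Θ (A x) (A v) := by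
  rw [fderiv_comp x hΘ A.differentiableAt, A.fderiv]
  rfl

/-- **Order two**: `D²(Θ∘A)(x)[u][v] = D²Θ(Ax)[Au][Av]` for `Θ ∈ C²`. [cite: Dieudonne1960, Ch. VIII §12 (8.12.10)] -/
theorem nestedFDeriv_two_comp_clm (A : E →L[ℝ] E') {Θ : E' → F} (hΘ : ContDiff ℝ 2 Θ) (x u v : E) :
    fderiv ℝ (fderiv ℝ (Θ ∘ A)) x u v = fderiv ℝ (fderiv ℝ Θ) (A x) (A u) (A v) := by
  have h := iteratedFDeriv_comp_clm_apply A hΘ x (j := 2) le_rfl ![u, v]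
  rw [iteratedFDeriv_two_apply, iteratedFDeriv_two_apply] at h
  simpa using h

/-- **Order three**: `D³(Θ∘A)(x)[a][b][c] = D³Θ(Ax)[Aa][Ab][Ac]` for `Θ ∈ C³`. [cite: Dieudonne1960, Ch. VIII §12 (8.12.10)] -/
theorem nestedFDeriv_three_comp_clm (A : E →L[ℝ] E') {Θ : E' → F} (hΘ : ContDiff ℝ 3 Θ) (x a b c : E) :
    fderiv ℝ (fderiv ℝ (fderiv ℝ (Θ ∘ A))) x a b c = fderiv ℝ (fderiv ℝ (fderiv ℝ Θ)) (A x) (A a) (A b) (A c) := by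
  have hc : ContDiff ℝ 3 (Θ ∘ A) := hΘ.comp A.contDiff
  have h := iteratedFDeriv_comp_clm_apply A hΘ x (j := 3) le_rfl ![a, b, c]
  have hv : (fun i => A ((![a, b, c] : Fin 3 → E) i)) = ![A a, A b, A c] := by
    funext i; fin_cases i <;> rfl
  rw [hv, iteratedFDeriv_three_eq_nestedFDeriv hc, iteratedFDeriv_three_eq_nestedFDeriv hΘ] at h
  exact h

/-- **Order four**: `D⁴(Θ∘A)(x)[a][b][c][d] = D⁴Θ(Ax)[Aa][Ab][Ac][Ad]` for `Θ ∈ C⁴`. [cite: Dieudonne1960, Ch. VIII §12 (8.12.10)] -/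
theorem nestedFDeriv_four_comp_clm (A : E →L[ℝ] E') {Θ : E' → F} (hΘ : ContDiff ℝ 4 Θ) (x a b c d : E) :
    fderiv ℝ (fderiv ℝ (fderiv ℝ (fderiv ℝ (Θ ∘ A)))) x a b c d = fderiv ℝ (fderiv ℝ (fderiv ℝ (fderiv ℝ Θ))) (A x) (A a) (A b) (A c) (A d) := by
  -- operator-norm instances of the triply nested CLM spaces (not found unaided, cf. ★ `NestedFDerivSymmetric`)
  letI i2 : NormedAddCommGroup (E →L[ℝ] E →L[ℝ] F) := inferInstance
  letI : NormedSpace ℝ (E →L[ℝ] E →L[ℝ] F) := inferInstance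
  letI i3 : NormedAddCommGroup (E →L[ℝ] E →L[ℝ] E →L[ℝ] F) := inferInstance
  letI : NormedSpace ℝ (E →L[ℝ] E →L[ℝ] E →L[ℝ] F) := inferInstance
  letI i2' : NormedAddCommGroup (E' →L[ℝ] E' →L[ℝ] F) := inferInstance
  letI : NormedSpace ℝ (E' →L[ℝ] E' →L[ℝ] F) := inferInstance
  letI i3' : NormedAddCommGroup (E' →L[ℝ] E' →L[ℝ] E' →L[ℝ] F) := inferInstance
  letI : NormedSpace ℝ (E' →L[ℝ] E' →L[ℝ] E' →L[ℝ] F) := inferInstance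
  have hc : ContDiff ℝ 4 (Θ ∘ A) := hΘ.comp A.contDiff
  have h := iteratedFDeriv_comp_clm_apply A hΘ x (j := 4) le_rfl ![a, b, c, d]
  have hv : (fun i => A ((![a, b, c, d] : Fin 4 → E) i)) = ![A a, A b, A c, A d] := by
    funext i; fin_cases i <;> rfl
  rw [hv, iteratedFDeriv_four_eq_nestedFDeriv hc, iteratedFDeriv_four_eq_nestedFDeriv hΘ] at h
  exact h

end Literature.Analysis.Calculus

end
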